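import Summits.QuantumFields.YangMills.Theorems.UnitScaleTiltProp7BlockDistanceWeights
import Summits.QuantumFields.YangMills.Theorems.UnitScaleTiltProp7Flat349Certificate
import Literature.MathematicalPhysics.QuantumFieldTheory.Balaban1983to89.B9Eq342CoshWeightSite
import HarnessLib

/-!
# Route `UnitScaleTilt`, crux K1 «MinimiserStabilityRegPr» (stmt-QuantumFields-19200), EX face after S45 — **(L3′b)-VALUE FILE V4b-1: THE COSH (AGMON) WEIGHT AT THE T³ MEMBER —
# SUPERSOLUTION IN V3's SHAPE, A K-UNIFORM RATE `≤ μ` PER BLOCK, AND DOMINATION OF THE BLOCK-DISTANCE EXPONENTIAL** (chair ★`ym-ust-19200-p1` g25's pen V4, CHAIR WORD №4 (c);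
# the weight letters that w5's V3 ✓`Prop7KatoBootstrapMemberDecay.norm_apply_le_of_kato_member_weighted_of_letter` displays)

Cell `ym3-torus` (HUMAN RULING D-0037; rung R3 = SU(2) YM₃ on T³ — NOT d = 4, NOT infinite volume, NOT a mass gap, NOT Clay).
THEOREMS ONLY (0 `def`, 0 `sorry`, default heartbeats); `--supports stmt-QuantumFields-19200 --as helper`; count-neutral.

THE WEIGHT (lit ✓`B9Eq342CoshWeightSite`, [Balaban1984PropagatorsI] p.36): on `TSite 3 (periodsT3 F K)`, centred at `x₀`, rate `a` per fine site,
`W_{x₀}(x) = Π_μ cosh(a·circAbs_μ(x₀ − x))` — positive, `W(x₀) = 1`, and a SUPERSOLUTION of the flat `η⁻²`-stencil: `λ·W ≤ (L₀ + 1)W`, `λ = 1 − 2·3·η⁻²(cosh a − 1)`.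
WHAT IS PROVED (ns `Summit.QuantumFields.YangMills.Theorems.Prop7MemberCoshWeight`).
* §1 `weight_supersolution_member` — lit ✓`weight_site_supersolution` at `t := η⁻¹`, `m := 1`: LITERALLY the `hsup` binder of V3; ★`exists_weight_rate` — for every `μ > 0` a rate `0 < a ≤ μη`
  (so `aℓ ≤ μ` per block, `ℓ = η⁻¹`) with `1∕2 ≤ λ` (lit ✓`exists_rate` + monotonicity of `cosh`) — K-UNIFORM per block.
* §2 ★★ `exp_tdist_le_weight` — `(1∕8)·e^{a·tdist x₀ x} ≤ W_{x₀}(x)` on the route's sites read through ✓`siteEquiv` (`cosh t ≥ e^t∕2` per coordinate, inlined; the coordinate `circAbs` dominates the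
  route's `min(val, val)` by px20's ✓`Prop7Flat349Certificate.min_val_le_circAbs`); ★★★ `exp_blockDist_le_weight` — `(1∕8)·e^{−3aℓ}·e^{aℓ·tdist(B(x₀), B(x))} ≤ W_{x₀}(x)` (coarse `ℓ¹` block distance;
  ✓`Prop7BlockDistanceWeights.tdist_iterBlockOf_le`: `ℓ·(tdist(Bx₀,Bx) − 3) ≤ tdist x₀ x`) — the weight-domination letter `hW` of lit ✓`B9Eq342BlockDecayWeightedSum` at the member's blocks.
HONEST SCOPE.  Weight bookkeeping only (no operator occurs); nothing of the ten EX rows, `hT`, `hGF`, EX or the crux is proved here.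

References: T. Bałaban, CMP **95** (1984) 17–40 [Balaban1984PropagatorsI] ((1.29) p.23, Prop. 1.1 p.33, p.36 — the Agmon weight); CMP **99** (1985) 389–434 [Balaban1985BackgroundPropagators]
(Thm 3.1 (3.42) p.397 with `e^{−δ₀d(y,y′)}`); CMP **98** (1985) 17–51 [Balaban1985Averaging] ((2) p.17).
-/

set_option autoImplicit false

noncomputable section

open scoped BigOperators

namespace Summit.QuantumFields.YangMills.Theorems.Prop7MemberCoshWeight

open Literature.MathematicalPhysics.QuantumFieldTheory.Balaban1983to89
open Literature.MathematicalPhysics.QuantumFieldTheory.Balaban1983to89.T3ContinuumYM3Torus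
open B5Eq118OneStroke (iterBlockOf)
open B4Sect5Torus (TSite)
open B9SectCLatticeCarrier (shift unshift)
open B4TorusKernel.MultiPeriod (circAbs circAbs_nonneg circAbs_add_mul)
open B9Eq342CoshWeightSite (weight_site_pos weight_site_centre weight_site_supersolution exists_rate)
open T3SectALandauChart (eta eta_pos)
open Summit.QuantumFields.YangMills.Theorems.Prop7SectET3Transport (periodsT3 siteEquiv siteEquiv_apply)
open Summit.QuantumFields.YangMills.Theorems.Prop7BlockDistanceWeights (tdist_iterBlockOf_le eta_mul_pow_eq_one)
open Summit.QuantumFields.YangMills.Theorems.Prop7Flat349Certificate (min_val_le_circAbs)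

variable (F : T3Family) (n K : ℕ)

/-! ## §1 The supersolution in V3's shape and a K-uniform rate -/

/-- **THE WEIGHT IS A SUPERSOLUTION OF THE MEMBER's FLAT `η⁻²`-STENCIL** — lit ✓`weight_site_supersolution` at `t := η⁻¹`, `m := 1`; the `hsup` binder of V3
✓`Prop7KatoBootstrapMemberDecay.norm_apply_le_of_kato_member_weighted_of_letter` with `λ := 1 − 2·3·η⁻²(cosh a − 1)`. [cite: Balaban1984PropagatorsI, p.36; Balaban1985BackgroundPropagators, (3.23) p.394] -/
theorem weight_supersolution_member (a : ℝ) (x₀ : TSite 3 (periodsT3 F K)) :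
    ∀ y : TSite 3 (periodsT3 F K),
      (1 - 2 * (3 : ℕ) * (eta F n K)⁻¹ ^ 2 * (Real.cosh a - 1)) *
          ∏ μ, Real.cosh (a * (circAbs (periodsT3 F K μ) (((((x₀ μ : ℕ) : ZMod (periodsT3 F K μ)) - ((y μ : ℕ) : ZMod (periodsT3 F K μ))).val : ℕ) : ℤ) : ℝ)) ≤
        ∑ j : Fin 3 ⊕ Fin 3, (eta F n K)⁻¹ ^ 2 *
            (∏ μ, Real.cosh (a * (circAbs (periodsT3 F K μ) (((((x₀ μ : ℕ) : ZMod (periodsT3 F K μ)) - ((y μ : ℕ) : ZMod (periodsT3 F K μ))).val : ℕ) : ℤ) : ℝ)) -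
              ∏ μ, Real.cosh (a * (circAbs (periodsT3 F K μ) (((((x₀ μ : ℕ) : ZMod (periodsT3 F K μ)) -
                (((Sum.elim (fun ν => unshift ν y) (fun ν => shift ν y) j : TSite 3 (periodsT3 F K)) μ : ℕ) : ZMod (periodsT3 F K μ))).val : ℕ) : ℤ) : ℝ))) +
          1 * ∏ μ, Real.cosh (a * (circAbs (periodsT3 F K μ) (((((x₀ μ : ℕ) : ZMod (periodsT3 F K μ)) - ((y μ : ℕ) : ZMod (periodsT3 F K μ))).val : ℕ) : ℤ) : ℝ)) :=
  fun y => weight_site_supersolution (periodsT3 F K) a (eta F n K)⁻¹ 1 x₀ y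

/-- ★ **A K-UNIFORM RATE**: for every `μ > 0` there is a rate `0 < a ≤ μ·η` (so `a·ℓ ≤ μ` per block) with `1∕2 ≤ λ = 1 − 2·3·η⁻²(cosh a − 1)` — lit ✓`exists_rate` at `t = η⁻¹`, `m = 1`,
cut down to `μη` by the monotonicity of `cosh`. [cite: Balaban1985BackgroundPropagators, Thm 3.1 p.397 («constants dependent on d and L only»); Balaban1984PropagatorsI, p.36] -/
theorem exists_weight_rate {μ : ℝ} (hμ : 0 < μ) :
    ∃ a : ℝ, 0 < a ∧ a ≤ μ * eta F n K ∧ a ≤ 1 ∧ (1 : ℝ) / 2 ≤ 1 - 2 * (3 : ℕ) * (eta F n K)⁻¹ ^ 2 * (Real.cosh a - 1) := by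
  obtain ⟨a₀, ha₀, ha₁, hrate⟩ := exists_rate (d := 3) (eta F n K)⁻¹ 1 one_pos
  have hη : 0 < eta F n K := eta_pos F n K
  refine ⟨min a₀ (μ * eta F n K), lt_min ha₀ (mul_pos hμ hη), min_le_right _ _, (min_le_left _ _).trans ha₁, ?_⟩
  have hcosh : Real.cosh (min a₀ (μ * eta F n K)) ≤ Real.cosh a₀ := by
    rw [Real.cosh_le_cosh, abs_of_nonneg (lt_min ha₀ (mul_pos hμ hη)).le, abs_of_nonneg ha₀.le]
    exact min_le_left _ _
  have h6 : 0 ≤ 2 * ((3 : ℕ) : ℝ) * (eta F n K)⁻¹ ^ 2 := by positivity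
  have := mul_le_mul_of_nonneg_left (sub_le_sub_right hcosh 1) h6
  linarith

/-! ## §2 The weight dominates the exponential of the fine and of the block distance -/

/-- `((ZMod.finEquiv N)⁻¹ z : ℕ) = z.val`. [folklore] -/
private theorem val_finEquiv_symm_eq {N : ℕ} [NeZero N] (z : ZMod N) : (((ZMod.finEquiv N).symm z : Fin N) : ℕ) = z.val := by
  cases N with
  | zero => exact absurd rfl (NeZero.ne 0)
  | succ N => rfl

/-- The coordinate of the chart is the residue: `((siteEquiv x μ : ℕ) : ZMod P) = x μ`. [folklore] -/
theorem natCast_siteEquiv (x : Site (F.P K) 0) (μ : Fin 3) :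
    (((siteEquiv F K x μ : ℕ)) : ZMod (periodsT3 F K μ)) = x μ := by
  have hval : ((siteEquiv F K x μ : ℕ)) = (x μ).val := by
    rw [siteEquiv_apply]; exact val_finEquiv_symm_eq (x μ)
  rw [hval]
  exact ZMod.natCast_zmod_val (x μ)

/-- The route's circular coordinate distance is dominated by the weight's `circAbs` of the residue difference. [folklore] -/
theorem min_val_le_circAbs_sub (x₀ x : Site (F.P K) 0) (μ : Fin 3) :
    ((min (x₀ μ - x μ).val (x μ - x₀ μ).val : ℕ) : ℝ)
      ≤ (circAbs (periodsT3 F K μ) (((((siteEquiv F K x₀ μ : ℕ) : ZMod (periodsT3 F K μ)) - ((siteEquiv F K x μ : ℕ) : ZMod (periodsT3 F K μ))).val : ℕ) : ℤ) : ℝ) := by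
  rw [natCast_siteEquiv, natCast_siteEquiv]
  have h1 := min_val_le_circAbs (N := periodsT3 F K μ) (x₀ μ) (x μ)
  -- `(x₀ − x).val ≡ x₀.val − x.val (mod N)`, and `circAbs` is `N`-periodic
  have hper : circAbs (periodsT3 F K μ) ((((x₀ μ - x μ).val : ℕ) : ℤ)) = circAbs (periodsT3 F K μ) (((x₀ μ).val : ℤ) - ((x μ).val : ℤ)) := by
    have hmod : ((((x₀ μ - x μ).val : ℕ) : ℤ)) = (((x₀ μ).val : ℤ) - ((x μ).val : ℤ)) % (periodsT3 F K μ : ℕ) := by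
      have : x₀ μ - x μ = ((((x₀ μ).val : ℤ) - ((x μ).val : ℤ) : ℤ) : ZMod (periodsT3 F K μ)) := by
        push_cast; rw [ZMod.natCast_zmod_val, ZMod.natCast_zmod_val]
      rw [this, ZMod.val_intCast]
    rw [hmod, Int.emod_def, sub_eq_add_neg, ← mul_neg, circAbs_add_mul]
  rw [hper]
  exact_mod_cast h1

/-- ★★ **THE WEIGHT DOMINATES THE EXPONENTIAL OF THE FINE DISTANCE**: for `0 ≤ a` and route sites `x₀ x`, `(1∕8)·e^{a·tdist x₀ x} ≤ W_{x₀}(x)` read on the chart.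
[cite: Balaban1984PropagatorsI, p.36; Balaban1985BackgroundPropagators, Thm 3.1 (3.42) p.397] -/
theorem exp_tdist_le_weight {a : ℝ} (ha : 0 ≤ a) (x₀ x : Site (F.P K) 0) :
    (1 / 8) * Real.exp (a * (Site.tdist x₀ x : ℝ)) ≤
      ∏ μ, Real.cosh (a * (circAbs (periodsT3 F K μ) (((((siteEquiv F K x₀ μ : ℕ) : ZMod (periodsT3 F K μ)) - ((siteEquiv F K x μ : ℕ) : ZMod (periodsT3 F K μ))).val : ℕ) : ℤ) : ℝ)) := by
  -- abbreviate the coordinate distances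
  set c : Fin 3 → ℝ := fun μ => (circAbs (periodsT3 F K μ) (((((siteEquiv F K x₀ μ : ℕ) : ZMod (periodsT3 F K μ)) - ((siteEquiv F K x μ : ℕ) : ZMod (periodsT3 F K μ))).val : ℕ) : ℤ) : ℝ) with hc
  have hsum : (Site.tdist x₀ x : ℝ) ≤ ∑ μ, c μ := by
    unfold Site.tdist
    rw [Nat.cast_sum]
    exact Finset.sum_le_sum fun μ _ => min_val_le_circAbs_sub F K x₀ x μ
  -- `Π cosh(a c_μ) ≥ Π e^{a c_μ}∕2 = e^{a Σ c_μ}∕8`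
  have hcosh : ∀ t : ℝ, Real.exp t / 2 ≤ Real.cosh t := fun t => by
    rw [Real.cosh_eq]; have := Real.exp_pos (-t); linarith
  have hprod : ∏ μ, (Real.exp (a * c μ) / 2) ≤ ∏ μ, Real.cosh (a * c μ) :=
    Finset.prod_le_prod (fun μ _ => by positivity) (fun μ _ => hcosh _)
  have hexp : ∏ μ, (Real.exp (a * c μ) / 2) = (1 / 8) * Real.exp (a * ∑ μ, c μ) := by
    rw [Finset.prod_div_distrib, ← Real.exp_sum, ← Finset.mul_sum, Finset.prod_const, Finset.card_univ, Fintype.card_fin]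
    norm_num; ring
  calc (1 / 8) * Real.exp (a * (Site.tdist x₀ x : ℝ)) ≤ (1 / 8) * Real.exp (a * ∑ μ, c μ) := by
        refine mul_le_mul_of_nonneg_left (Real.exp_le_exp.mpr (mul_le_mul_of_nonneg_left hsum ha)) (by norm_num)
    _ = ∏ μ, (Real.exp (a * c μ) / 2) := hexp.symm
    _ ≤ _ := hprod

/-- ★★★ **THE WEIGHT DOMINATES THE EXPONENTIAL OF THE BLOCK DISTANCE**: `(1∕8)·e^{−3aℓ}·e^{aℓ·tdist(B(x₀), B(x))} ≤ W_{x₀}(x)` (`ℓ = L^{K−n}`, `B = iterBlockOf (K − n)`, coarse `ℓ¹`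
distance) — `ℓ·(tdist(Bx₀, Bx) − 3) ≤ tdist x₀ x` (✓`tdist_iterBlockOf_le`).  The `hW`∕`hWd` letter of lit ✓`B9Eq342BlockDecayWeightedSum` at the member's blocks, rate `κ₁ = aℓ` per block.
[cite: Balaban1985BackgroundPropagators, Thm 3.1 (3.42) p.397, (3.49) p.399; Balaban1985Averaging, (2) p.17] -/
theorem exp_blockDist_le_weight (hnK : n ≤ K) {a : ℝ} (ha : 0 ≤ a) (x₀ x : Site (F.P K) 0) :
    (1 / 8) * Real.exp (-(3 * (a * (F.L : ℝ) ^ (K - n)))) * Real.exp (a * (F.L : ℝ) ^ (K - n) * (Site.tdist (iterBlockOf (K - n) x₀) (iterBlockOf (K - n) x) : ℝ)) ≤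
      ∏ μ, Real.cosh (a * (circAbs (periodsT3 F K μ) (((((siteEquiv F K x₀ μ : ℕ) : ZMod (periodsT3 F K μ)) - ((siteEquiv F K x μ : ℕ) : ZMod (periodsT3 F K μ))).val : ℕ) : ℤ) : ℝ)) := by
  have hk : K - n ≤ (F.P K).m + (F.P K).K := by show K - n ≤ F.m + K; omega
  have hL : (0 : ℝ) < F.L := by have := F.hL.2; exact_mod_cast (by omega : 0 < F.L)
  have hℓ : (0 : ℝ) < (F.L : ℝ) ^ (K - n) := by positivity
  -- `ℓ·tdist_c ≤ tdist + 3ℓ` in `ℕ`, hence in `ℝ`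
  have hnat := tdist_iterBlockOf_le (P := F.P K) hk x₀ x
  have hPL : (F.P K).L = F.L := rfl
  have hPd : (F.P K).d = 3 := rfl
  rw [hPL, hPd] at hnat
  have hreal : (F.L : ℝ) ^ (K - n) * (Site.tdist (iterBlockOf (K - n) x₀) (iterBlockOf (K - n) x) : ℝ) ≤ (Site.tdist x₀ x : ℝ) + 3 * (F.L : ℝ) ^ (K - n) := by
    have h1 : F.L ^ (K - n) * Site.tdist (iterBlockOf (K - n) x₀) (iterBlockOf (K - n) x) ≤ Site.tdist x₀ x + 3 * F.L ^ (K - n) := by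
      calc F.L ^ (K - n) * Site.tdist (iterBlockOf (K - n) x₀) (iterBlockOf (K - n) x)
          ≤ F.L ^ (K - n) * (Site.tdist x₀ x / F.L ^ (K - n) + 3) := Nat.mul_le_mul_left _ hnat
        _ = F.L ^ (K - n) * (Site.tdist x₀ x / F.L ^ (K - n)) + 3 * F.L ^ (K - n) := by ring
        _ ≤ Site.tdist x₀ x + 3 * F.L ^ (K - n) := Nat.add_le_add_right (Nat.mul_div_le _ _) _
    exact_mod_cast h1
  have hexp : Real.exp (-(3 * (a * (F.L : ℝ) ^ (K - n)))) * Real.exp (a * (F.L : ℝ) ^ (K - n) * (Site.tdist (iterBlockOf (K - n) x₀) (iterBlockOf (K - n) x) : ℝ))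
      ≤ Real.exp (a * (Site.tdist x₀ x : ℝ)) := by
    rw [← Real.exp_add, Real.exp_le_exp]
    have := mul_le_mul_of_nonneg_left hreal ha
    nlinarith
  calc (1 / 8) * Real.exp (-(3 * (a * (F.L : ℝ) ^ (K - n)))) * Real.exp (a * (F.L : ℝ) ^ (K - n) * (Site.tdist (iterBlockOf (K - n) x₀) (iterBlockOf (K - n) x) : ℝ))
      = (1 / 8) * (Real.exp (-(3 * (a * (F.L : ℝ) ^ (K - n)))) * Real.exp (a * (F.L : ℝ) ^ (K - n) * (Site.tdist (iterBlockOf (K - n) x₀) (iterBlockOf (K - n) x) : ℝ))) := by ring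
    _ ≤ (1 / 8) * Real.exp (a * (Site.tdist x₀ x : ℝ)) := mul_le_mul_of_nonneg_left hexp (by norm_num)
    _ ≤ _ := exp_tdist_le_weight F K ha x₀ x

end Summit.QuantumFields.YangMills.Theorems.Prop7MemberCoshWeight

end
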